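import Summits.QuantumAdvantage.QuantumAdvantage.Theorems.StabilizerDialAntipodalA

/-! # StabilizerDialAntipodalB — part 2/5 (mechanical split for landing of `StabilizerDialAntipodal`; content verbatim; scopes re-opened with their variables) -/

set_option linter.dupNamespace false
noncomputable section
open scoped Classical

namespace Summit.QuantumAdvantage.QuantumAdvantage.Theorems.StabilizerDial
open Finset
open Literature.Computability.QuantumComplexity Literature.Computability.QuantumComplexity.RingHLF
open Literature.Computability.MetaComplexity Literature.Computability.MetaComplexity.Smolensky
open Summit.QuantumAdvantage.AdviceFreeQNC0
open Summit.QuantumAdvantage.QuantumAdvantage.Theorems.HolonomyDial (selP selP_mem selP_apply xorP xorP_mem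
  xorP_apply_bool tPoly tPoly_mem tPoly_apply mono_singleton_apply card_odd_le)
open Summit.QuantumAdvantage.QuantumAdvantage.Theorems.AnchorDial (outB dev card_odd_ge)
open Summit.QuantumAdvantage.QuantumAdvantage.Theorems.LocusDial (Coverable FewLocus)
variable {N : ℕ}

/-- the count `|{t < k : λ_t = 1}|`. -/
def lamCnt (k : ℕ) (w : ℕ → Bool) (u v : Bool) : ℕ := ((Finset.range k).filter fun t => lam w u v t = true).card

/-- StabilizerDialAntipodal helper `lamCnt_lower` (antipodal certificate; see the module docstring). -/
theorem lamCnt_lower (k : ℕ) (hk : 3 ≤ k) (w : ℕ → Bool) {u v : Bool} (huv : ¬ (u = false ∧ v = false)) :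
    k ≤ 3 * lamCnt k w u v := by
  have hf := lam_false_card_le w huv k
  have hsplit := Finset.card_filter_add_card_filter_not (s := Finset.range k) (fun t => lam w u v t = true)
  rw [Finset.card_range] at hsplit
  have he : ((Finset.range k).filter fun t => ¬ lam w u v t = true).card =
      ((Finset.range k).filter fun t => lam w u v t = false).card := by
    congr 1; ext t; simp
  rw [he] at hsplit
  unfold lamCnt
  omega

/-- StabilizerDialAntipodal helper `lamCnt_sum` (antipodal certificate; see the module docstring). -/
theorem lamCnt_sum (k : ℕ) (w : ℕ → Bool) :
    lamCnt k w true false + lamCnt k w false true + lamCnt k w true true = 2 * k := by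
  unfold lamCnt
  rw [Finset.card_filter, Finset.card_filter, Finset.card_filter, ← Finset.sum_add_distrib, ← Finset.sum_add_distrib,
    Finset.sum_congr rfl fun i _ => lam_two_of_three w i]
  simp [mul_comm]

/-- the seed (among the three non-zero ones) minimising the count. -/
def seedSel (k : ℕ) (w : ℕ → Bool) : Bool × Bool :=
  if lamCnt k w true false ≤ lamCnt k w false true ∧ lamCnt k w true false ≤ lamCnt k w true true then (true, false)
  else if lamCnt k w false true ≤ lamCnt k w true true then (false, true) else (true, true)

/-- StabilizerDialAntipodal helper `seedSel_ne` (antipodal certificate; see the module docstring). -/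
theorem seedSel_ne (k : ℕ) (w : ℕ → Bool) : ¬ ((seedSel k w).1 = false ∧ (seedSel k w).2 = false) := by
  unfold seedSel; split_ifs <;> simp

/-- StabilizerDialAntipodal helper `seedSel_min` (antipodal certificate; see the module docstring). -/
theorem seedSel_min (k : ℕ) (w : ℕ → Bool) : 3 * lamCnt k w (seedSel k w).1 (seedSel k w).2 ≤ 2 * k := by
  have hsum := lamCnt_sum k w
  unfold seedSel; split_ifs with h1 h2 <;> simp only <;> omega

/-- the block word `t ↦ x_{a+t}` (`t < k`; `false` elsewhere). -/
def blockWord (a k : ℕ) (x : Fin N → Bool) (t : ℕ) : Bool := if h : t < k ∧ a + t < N then x ⟨a + t, h.2⟩ else false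

/-- StabilizerDialAntipodal helper `blockWord_eq` (antipodal certificate; see the module docstring). -/
theorem blockWord_eq (a k : ℕ) (x : Fin N → Bool) {t : ℕ} (ht : t < k) (h : a + t < N) :
    blockWord a k x t = x ⟨a + t, h⟩ := dif_pos ⟨ht, h⟩

/-- the antipodal embedding `t ↦ a + ⌊N/2⌋ + t (mod N)`. -/
def apEmb (hN : 0 < N) (a t : ℕ) : Fin N := ⟨(a + N / 2 + t) % N, Nat.mod_lt _ hN⟩

/-- StabilizerDialAntipodal helper `apEmb_val` (antipodal certificate; see the module docstring). -/
theorem apEmb_val (hN : 0 < N) {a t : ℕ} (h : a + N / 2 + t < N) : (apEmb hN a t).val = a + N / 2 + t :=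
  Nat.mod_eq_of_lt h

/-- the four boundary coefficients `(λ₀, λ₁ ⊕ λ₀x_a, λ_{k-2} ⊕ λ_{k-1}x_{a+k-1}, λ_{k-1})`. -/
def cVec (k : ℕ) (w : ℕ → Bool) (u v : Bool) : Fin 4 → Bool :=
  ![lam w u v 0, xor (lam w u v 1) (lam w u v 0 && w 0), xor (lam w u v (k - 2)) (lam w u v (k - 1) && w (k - 1)),
    lam w u v (k - 1)]

/-- StabilizerDialAntipodal helper `fin_arg_eq` (antipodal certificate; see the module docstring). -/
theorem fin_arg_eq (β : Fin N → Bool) {i j : ℕ} (hi : i < N) (hj : j < N) (h : i = j) : β ⟨i, hi⟩ = β ⟨j, hj⟩ := by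
  subst h; rfl

/-- **S1 (fibre identity) — PROVED** (scalar adjoint form of the affine unrolling). -/
theorem fibreIdentityAt_of_block (N a k : ℕ) (hk : 3 ≤ k) (ha : 1 ≤ a) (hak : a + k + 1 ≤ N / 2) : FibreIdentityAt N a k := by
  have hN : 0 < N := by omega
  have apEmb_inj : ∀ x : Fin N → Bool, Set.InjOn (apEmb hN a)
      ↑((Finset.range k).filter fun t =>
        lam (blockWord a k x) (seedSel k (blockWord a k x)).1 (seedSel k (blockWord a k x)).2 t = true) := by
    intro x t ht t' ht' h
    rw [Finset.coe_filter, Set.mem_setOf_eq, Finset.mem_range] at ht ht'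
    have := congrArg Fin.val h
    rwa [apEmb_val hN (by omega), apEmb_val hN (by omega), Nat.add_left_cancel_iff] at this
  refine ⟨fun x => cVec k (blockWord a k x) (seedSel k (blockWord a k x)).1 (seedSel k (blockWord a k x)).2,
    fun x => ((Finset.range k).filter fun t =>
      lam (blockWord a k x) (seedSel k (blockWord a k x)).1 (seedSel k (blockWord a k x)).2 t = true).image (apEmb hN a),
    ?_, ?_, ?_⟩
  · -- (i) block-determined
    intro x x' hxx'
    have hw : blockWord a k x = blockWord a k x' := by
      funext t
      unfold blockWord
      split_ifs with h
      · exact hxx' ⟨a + t, h.2⟩ (by simp) (by simp; omega)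
      · rfl
    beta_reduce
    rw [hw]; exact ⟨rfl, rfl⟩
  · -- (ii) support and size of `T`
    intro x
    refine ⟨?_, ?_, ?_⟩
    · intro i hi
      rw [Finset.mem_image] at hi
      obtain ⟨t, ht, rfl⟩ := hi
      rw [Finset.mem_filter, Finset.mem_range] at ht
      rw [apEmb_val hN (by omega)]; omega
    · rw [Finset.card_image_of_injOn (apEmb_inj x)]
      exact lamCnt_lower k hk _ (seedSel_ne k _)
    · rw [Finset.card_image_of_injOn (apEmb_inj x)]
      exact seedSel_min k _
  · -- (iii) the identity
    intro x β h0 h1 h2 h3 hrec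
    beta_reduce
    set w := blockWord a k x with hwdef
    set u := (seedSel k w).1 with hudef
    set v := (seedSel k w).2 with hvdef
    obtain ⟨Bs, hBs⟩ : ∃ Bs : ℕ → Bool, ∀ i (hi : a - 1 + i < N), Bs i = β ⟨a - 1 + i, hi⟩ :=
      ⟨fun i => if h : a - 1 + i < N then β ⟨a - 1 + i, h⟩ else false, fun i hi => dif_pos hi⟩
    obtain ⟨ya, hya⟩ : ∃ ya : ℕ → Bool, ∀ t (ht : a + N / 2 + t < N), ya t = x ⟨a + N / 2 + t, ht⟩ :=
      ⟨fun t => if h : a + N / 2 + t < N then x ⟨a + N / 2 + t, h⟩ else false, fun t ht => dif_pos ht⟩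
    -- the block equations
    have hE : ∀ t < k, xor (xor (Bs t) (Bs (t + 2))) (w t && Bs (t + 1)) = ya t := by
      intro t ht
      have hj : a + t < N := by omega
      have h := hrec ⟨a + t, hj⟩ (by simp) (by simp; omega)
      have hprv : prv (⟨a + t, hj⟩ : Fin N) = ⟨a - 1 + t, by omega⟩ := by
        apply Fin.ext
        show (a + t + N - 1) % N = a - 1 + t
        rw [show a + t + N - 1 = (a - 1 + t) + N by omega, Nat.add_mod_right, Nat.mod_eq_of_lt (by omega)]
      have hnxt : nxt (⟨a + t, hj⟩ : Fin N) = ⟨a - 1 + (t + 2), by omega⟩ := by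
        apply Fin.ext
        show (a + t + 1) % N = a - 1 + (t + 2)
        rw [Nat.mod_eq_of_lt (by omega)]; omega
      have hap : apIdx (⟨a + t, hj⟩ : Fin N) = ⟨a + N / 2 + t, by omega⟩ := by
        apply Fin.ext
        show (a + t + N / 2) % N = a + N / 2 + t
        rw [Nat.mod_eq_of_lt (by omega)]; omega
      unfold rowVec at h
      rw [hprv, hnxt, hap, fin_arg_eq β hj (by omega) (show a + t = a - 1 + (t + 1) by omega)] at h
      rw [hBs t (by omega), hBs (t + 2) (by omega), hBs (t + 1) (by omega), hya t (by omega),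
        hwdef, blockWord_eq a k x ht hj]
      exact h
    -- telescoping
    obtain ⟨d, rfl⟩ : ∃ d, k = d + 2 := ⟨k - 2, by omega⟩
    have key := lam_telescope w Bs u v d
    rw [xsum_congr (t := d + 2) (g' := fun t => lam w u v t && ya t) (fun t ht => by simp only [hE t ht]),
      xsum_eq_parity] at key
    -- the goal's left-hand side is the boundary form
    have q0 : β ⟨a - 1, h0⟩ = Bs 0 := (hBs 0 (by omega)).symm
    have q1 : β ⟨a, h1⟩ = Bs 1 := (fin_arg_eq β h1 (by omega) (by omega)).trans (hBs 1 (by omega)).symm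
    have q2 : β ⟨a + (d + 2) - 1, h2⟩ = Bs (d + 2) :=
      (fin_arg_eq β h2 (by omega) (by omega)).trans (hBs (d + 2) (by omega)).symm
    have q3 : β ⟨a + (d + 2), h3⟩ = Bs (d + 3) :=
      (fin_arg_eq β h3 (by omega) (by omega)).trans (hBs (d + 3) (by omega)).symm
    have c0 : cVec (d + 2) w u v 0 = lam w u v 0 := rfl
    have c1 : cVec (d + 2) w u v 1 = xor (lam w u v 1) (lam w u v 0 && w 0) := rfl
    have c2 : cVec (d + 2) w u v 2 = xor (lam w u v d) (lam w u v (d + 1) && w (d + 1)) := by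
      show xor (lam w u v (d + 2 - 2)) (lam w u v (d + 2 - 1) && w (d + 2 - 1)) = _
      rw [Nat.add_sub_cancel, show d + 2 - 1 = d + 1 by omega]
    have c3 : cVec (d + 2) w u v 3 = lam w u v (d + 1) := by
      show lam w u v (d + 2 - 1) = _
      rw [show d + 2 - 1 = d + 1 by omega]
    rw [c0, c1, c2, c3, q0, q1, q2, q3, ← key]
    -- parity over `T` = parity of the summands
    have hpt : ∀ (t : ℕ) (ht : a + N / 2 + t < N), (⟨a + N / 2 + t, ht⟩ : Fin N) = apEmb hN a t :=
      fun t ht => Fin.ext (apEmb_val hN ht).symm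
    have hcard : ((((Finset.range (d + 2)).filter fun t => lam w u v t = true).image (apEmb hN a)).filter
        fun i => x i = true).card = ((Finset.range (d + 2)).filter fun t => (lam w u v t && ya t) = true).card := by
      rw [Finset.filter_image, Finset.card_image_of_injOn, Finset.filter_filter]
      · congr 1
        apply Finset.filter_congr
        intro t ht
        rw [Finset.mem_range] at ht
        rw [hya t (by omega), Bool.and_eq_true, hpt t (by omega)]
      · intro t ht t' ht' h
        rw [Finset.coe_filter, Set.mem_setOf_eq, Finset.mem_filter, Finset.mem_range] at ht ht'
        have := congrArg Fin.val h
        rwa [apEmb_val hN (by omega), apEmb_val hN (by omega), Nat.add_left_cancel_iff] at this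
    unfold parB
    rw [hcard]

/-- **ODD-SLICE SMOLENSKY on `{0,1}^N`**: for disjoint `T, T'`, a polynomial of degree `≤ D` (`D ≥ 1`) agrees with the parity over `T`,
inside the slice `par_{T ∪ T'} = c` of the sub-cube where every other coordinate is frozen to `w`, on at most
`2^{|T|+|T'|-2} + D·C(|T|,|T|/2)·2^{|T'|} + 2D·C(|T'|,|T'|/2)·2^{|T|}` points. -/
def OddSliceBound (N : ℕ) : Prop :=
  ∀ (D : ℕ), 1 ≤ D → ∀ (T T' : Finset (Fin N)), Disjoint T T' → ∀ (Q : CubeFn (ZMod 3) N), Q ∈ lowDeg (ZMod 3) N D →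
    ∀ (w : Fin N → Bool) (c : Bool),
      (univ.filter fun x : Fin N → Bool =>
          (∀ i, i ∉ T → i ∉ T' → x i = w i) ∧ parB (T ∪ T') x = c ∧ Q x = if parB T x then 1 else 0).card ≤
        2 ^ (T.card + T'.card - 2) + D * T.card.choose (T.card / 2) * 2 ^ T'.card
          + 2 * D * T'.card.choose (T'.card / 2) * 2 ^ T.card

/-! ### Sub-cube counting, restricted Smolensky, and the proof of S2 -/

/-- StabilizerDialAntipodal helper `decide_succ_mod_two` (antipodal certificate; see the module docstring). -/
theorem decide_succ_mod_two (c : ℕ) : decide ((c + 1) % 2 = 1) = !decide (c % 2 = 1) := by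
  have : (c + 1) % 2 = (c % 2 + 1) % 2 := by omega
  rcases Nat.mod_two_eq_zero_or_one c with h | h <;> simp [this, h]

/-- StabilizerDialAntipodal helper `ite_parB` (antipodal certificate; see the module docstring). -/
theorem ite_parB (T : Finset (Fin N)) (x : Fin N → Bool) :
    (if parB T x then (1 : ZMod 3) else 0) = if (T.filter fun i => x i = true).card % 2 = 1 then 1 else 0 := by
  by_cases h : (T.filter fun i => x i = true).card % 2 = 1 <;> simp [parB, h]

/-- StabilizerDialAntipodal helper `parB_congr` (antipodal certificate; see the module docstring). -/
theorem parB_congr {T : Finset (Fin N)} {x y : Fin N → Bool} (h : ∀ i ∈ T, x i = y i) : parB T x = parB T y := by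
  unfold parB
  rw [Finset.filter_congr (p := fun i => x i = true) (q := fun i => y i = true) (fun i hi => by rw [h i hi])]

/-- StabilizerDialAntipodal helper `parB_update_of_not_mem` (antipodal certificate; see the module docstring). -/
theorem parB_update_of_not_mem {T : Finset (Fin N)} {i : Fin N} (hi : i ∉ T) (x : Fin N → Bool) (b : Bool) :
    parB T (Function.update x i b) = parB T x :=
  parB_congr fun j hj => by rw [Function.update_apply, if_neg (by rintro rfl; exact hi hj)]

/-- StabilizerDialAntipodal helper `parB_union` (antipodal certificate; see the module docstring). -/
theorem parB_union {T T' : Finset (Fin N)} (hTT : Disjoint T T') (x : Fin N → Bool) :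
    parB (T ∪ T') x = xor (parB T x) (parB T' x) := by
  unfold parB
  rw [Finset.filter_union, Finset.card_union_of_disjoint (Finset.disjoint_filter_filter hTT)]
  generalize (T.filter fun i => x i = true).card = u
  generalize (T'.filter fun i => x i = true).card = v
  have : (u + v) % 2 = (u % 2 + v % 2) % 2 := by omega
  rcases Nat.mod_two_eq_zero_or_one u with hu | hu <;> rcases Nat.mod_two_eq_zero_or_one v with hv | hv <;>
    simp [this, hu, hv]

/-- StabilizerDialAntipodal helper `parB_update_flip` (antipodal certificate; see the module docstring). -/
theorem parB_update_flip {T : Finset (Fin N)} {i : Fin N} (hi : i ∈ T) (x : Fin N → Bool) :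
    parB T (Function.update x i (!x i)) = !parB T x := by
  unfold parB
  rw [← Finset.insert_erase hi, Finset.filter_insert, Finset.filter_insert]
  have hrest : ((T.erase i).filter fun j => Function.update x i (!x i) j = true) =
      (T.erase i).filter fun j => x j = true :=
    Finset.filter_congr fun j hj => by rw [Function.update_apply, if_neg (Finset.ne_of_mem_erase hj)]
  rw [hrest, Function.update_self]
  have hni : i ∉ (T.erase i).filter fun j => x j = true := fun h => Finset.notMem_erase i T (Finset.mem_of_mem_filter _ h)
  cases hx : x i <;> simp [Finset.card_insert_of_notMem hni, decide_succ_mod_two]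

/-- one coordinate that a predicate ignores doubles its count. -/
theorem card_filter_update_inv (i : Fin N) (b₀ : Bool) (P : (Fin N → Bool) → Prop) [DecidablePred P]
    (hP : ∀ x b, P x → P (Function.update x i b)) :
    (univ.filter P).card = 2 * (univ.filter fun x => x i = b₀ ∧ P x).card := by
  rw [← Finset.card_filter_add_card_filter_not (s := univ.filter P) (fun x => x i = b₀),
    Finset.filter_filter, Finset.filter_filter, two_mul]
  congr 1
  · congr 1; ext x; simp only [mem_filter, mem_univ, true_and]; tauto
  · refine Finset.card_bij' (fun x _ => Function.update x i b₀) (fun x _ => Function.update x i (!b₀)) ?_ ?_ ?_ ?_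
    · intro x hx
      rw [mem_filter] at hx ⊢
      exact ⟨mem_univ _, by rw [Function.update_self], hP x b₀ hx.2.1⟩
    · intro x hx
      rw [mem_filter] at hx ⊢
      refine ⟨mem_univ _, hP x _ hx.2.2, ?_⟩
      rw [Function.update_self]; cases b₀ <;> decide
    · intro x hx
      rw [mem_filter] at hx
      rw [Function.update_idem]
      have : (!b₀) = x i := by
        have h := hx.2.2; revert h; generalize x i = c; cases c <;> cases b₀ <;> decide
      rw [this, Function.update_eq_self]
    · intro x hx
      rw [mem_filter] at hx
      rw [Function.update_idem, ← hx.2.1, Function.update_eq_self]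


end Summit.QuantumAdvantage.QuantumAdvantage.Theorems.StabilizerDial
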